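import Mathlib
import HarnessLib
import Summits.NavierStokesRegularity.NavierStokesRegularity.Theorems.HalfSpaceWindowDoorCirculationCarryingRigidityGaussExtremalJoint

/-!
# Route `HalfSpaceWindowDoor`, crux `CirculationCarryingRigidity` (stmt-NavierStokesRegularity-25311) —
# the Gaussian-extremal normal form INSIDE AN INVARIANT SUB-CLASS

LEAD ns-hsw-p1 g9 (cell pub-ns-dss), `--supports stmt-NavierStokesRegularity-25311 --as helper`; tool file for the census line
`blowdown` (card `Cruxes/CirculationCarryingRigidity/Lines/blowdown.md`).  The normal form `exists_gaussExtremal'` (p669157) realises the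
supremum `Λ` of the scale-invariant Gaussian axial angular momentum of an enemy of W6 on ONE closed-hemisphere door-class profile `W`,
built from the enemy by backward time shifts, Navier–Stokes zooms about the maximising axes and the `C¹_loc` compactness of the class
(F3 = `exists_tendsto_of_isTypeIAncientMild_seq`).  Consequently EVERY structural property `P` of the enemy which is

* invariant under backward time shifts `v ↦ (σ ↦ v(σ − δ))`, `δ ≥ 0`,
* invariant under the zooms `v ↦ c • stPull (c²) c 0 x₀ v = ((σ, y) ↦ c·v(c²σ, x₀ + c·y))`, `c > 0`, and
* closed under the F3 convergence (slices and their gradients converge pointwise and locally uniformly on the open slab, inside the class)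

is inherited by the extremal profile (`exists_gaussExtremal_of_invariant`) — exactly as the closed-hemisphere sign itself is.  Hence the
joint first/second-order extremal system of `…GaussExtremalJoint` may be confronted with any such `P` on ONE object
(`inner_curl_e3_eq_zero_of_invariant`, `inner_curl_e3_eq_zero_of_invariant_joint`): a census stratum {closed hemisphere} ∩ {P} of W6 is
DEAD as soon as no single closed-hemisphere door-class `W ∈ P` carries the extremal system.  (The analogous tool for the POINTWISE extremal
of line `extremal` is `…ExtremalInvariant`, p626759.)  First consumer: `…GaussExtremalCone` (LRT's cone `|ω_h| ≤ K ω₃` in the time-only class).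

WHAT THIS IS NOT: not a statement about Navier–Stokes regularity; door statements concern HYPOTHETICAL blow-up profiles (KNSS ancient mild
solutions).  No item is closed by this file.
-/

noncomputable section

-- the summit and its single sub-problem share the name (CONVENTIONS §1), as in every Theorems file
set_option linter.dupNamespace false

namespace Summit.NavierStokesRegularity.NavierStokesRegularity.Theorems.HalfSpaceWindowDoorCirculationCarryingRigidityGaussExtremalInvariant

open MeasureTheory Set Function Filter Topology
open scoped RealInnerProductSpace InnerProductSpace Laplacian
open Literature.Analysis Literature.Analysis.FluidPDE Literature.Analysis.UnboundedOperators
open Summit.NavierStokesRegularity.NavierStokesRegularity.Theses.HalfSpaceWindowDoor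
open Summit.NavierStokesRegularity.NavierStokesRegularity.Theorems.HalfSpaceWindowDoorCirculationCarryingRigidityDefs
open Summit.NavierStokesRegularity.NavierStokesRegularity.Theorems.HalfSpaceWindowDoorCirculationCarryingRigidityGaussBlowdown
  (gaussAngMom_zoom tendsto_gaussAngMom)
open Summit.NavierStokesRegularity.NavierStokesRegularity.Theorems.HalfSpaceWindowDoorCirculationCarryingRigidityGaussCirculation
  (gaussianCirculation_holds)
open Summit.NavierStokesRegularity.NavierStokesRegularity.Theorems.HalfSpaceWindowDoorCirculationCarryingRigidityHorizontalVorticityFloor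
  (tendsto_curl_of_tendsto_fderiv)
open Summit.NavierStokesRegularity.NavierStokesRegularity.Theorems.PoloidalWindowDoorPoloidalWindowRigidityWindow
  (isTypeIAncientMild_of_class)
open Summit.NavierStokesRegularity.NavierStokesRegularity.Theorems
  (exists_tendsto_of_isTypeIAncientMild_seq isTypeIAncientMild_zoom zoom_apply)
open Summit.NavierStokesRegularity.NavierStokesRegularity.Theorems.HalfSpaceWindowDoorCirculationCarryingRigidityGaussExtremal
  (inDoorClass_of_isTypeIAncientMild gaussInflow_eq_of_isLocalMax)
open Summit.NavierStokesRegularity.NavierStokesRegularity.Theorems.HalfSpaceWindowDoorCirculationCarryingRigidityGaussExtremalFamily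
  (abs_gaussAngMom_le_of_le_neg)
open Summit.NavierStokesRegularity.NavierStokesRegularity.Theorems.HalfSpaceWindowDoorCirculationCarryingRigidityGaussSwirlLaw
  (gaussianSwirlLaw_holds)
open Summit.NavierStokesRegularity.NavierStokesRegularity.Theorems.HalfSpaceWindowDoorCirculationCarryingRigidityGaussInflowLaw
  (hasDerivAt_gaussInflow_of_class)
open Summit.NavierStokesRegularity.NavierStokesRegularity.Theorems.HalfSpaceWindowDoorCirculationCarryingRigidityGaussExtremalSecondOrder
  (deriv_nonneg_of_max_of_swirl exists_pressure_deriv_eq_of_class)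
open Summit.NavierStokesRegularity.NavierStokesRegularity.Theorems.HalfSpaceWindowDoorCirculationCarryingRigidityGaussExtremalJoint
  (firstOrder_of_extremal moments_of_extremal tilting_of_extremal)

variable {C : ℝ}

/-- **GAUSSIAN-EXTREMAL NORMAL FORM INSIDE AN INVARIANT SUB-CLASS.**  Let `P` be a property of profiles which, on the Type-I ancient mild
class with constant `C`, is invariant under backward time shifts and under the Navier–Stokes zooms `c • stPull (c²) c 0 x₀`, and is closed
under the F3 convergence of `exists_tendsto_of_isTypeIAncientMild_seq` (pointwise and locally uniform convergence of the slices and of their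
gradients at every negative time, all terms and the limit in the class).  If some closed-hemisphere door-class profile `v ∈ P` (constant `C`)
has `⟪curl v(s)(y), e₃⟫ > 0` somewhere, then there is a closed-hemisphere door-class profile `W ∈ P` (same `C`) whose Gaussian angular
momentum over ALL times `σ < 0`, scales `0 < t ≤ −σ` and axes is maximal at `(t, σ, y₀) = (1, −1, 0)`, with `Λ = 𝒢(1;0)[W(−1)] > 0` and
maximal inflow `ℐ(1;0)[W(−1)] = −2Λ`. -/
theorem exists_gaussExtremal_of_invariant (P : (ℝ → EuclideanSpace ℝ (Fin 3) → EuclideanSpace ℝ (Fin 3)) → Prop)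
    (hshift : ∀ u : (ℝ → EuclideanSpace ℝ (Fin 3) → EuclideanSpace ℝ (Fin 3)), IsTypeIAncientMild C u → P u → ∀ δ : ℝ, 0 ≤ δ → P (fun σ => u (σ - δ)))
    (hzoom : ∀ u : (ℝ → EuclideanSpace ℝ (Fin 3) → EuclideanSpace ℝ (Fin 3)), IsTypeIAncientMild C u → P u → ∀ c : ℝ, 0 < c → ∀ x₀ : EuclideanSpace ℝ (Fin 3),
      P (c • stPull (c ^ 2) c 0 x₀ u))
    (hlim : ∀ (w : ℕ → (ℝ → EuclideanSpace ℝ (Fin 3) → EuclideanSpace ℝ (Fin 3))) (W : (ℝ → EuclideanSpace ℝ (Fin 3) → EuclideanSpace ℝ (Fin 3))), (∀ j, IsTypeIAncientMild C (w j)) → (∀ j, P (w j)) → IsTypeIAncientMild C W →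
      (∀ t < 0, ∀ x, Tendsto (fun j => w j t x) atTop (𝓝 (W t x))) →
      (∀ t < 0, ∀ x, Tendsto (fun j => fderiv ℝ (w j t) x) atTop (𝓝 (fderiv ℝ (W t) x))) →
      (∀ t < 0, TendstoLocallyUniformly (fun j => w j t) (W t) atTop) →
      (∀ t < 0, TendstoLocallyUniformly (fun j => fderiv ℝ (w j t)) (fderiv ℝ (W t)) atTop) → P W)
    {v : (ℝ → EuclideanSpace ℝ (Fin 3) → EuclideanSpace ℝ (Fin 3))} (hv : InDoorClass C v) (hPv : P v)
    (hsign : SignE3 v) (hpos : ∃ s < 0, ∃ y, 0 < ⟪curl (v s) y, e3⟫) :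
    ∃ W : (ℝ → EuclideanSpace ℝ (Fin 3) → EuclideanSpace ℝ (Fin 3)), InDoorClass C W ∧ SignE3 W ∧ P W ∧
      0 < gaussAngMom 1 0 (W (-1)) ∧
      (∀ σ < 0, ∀ t : ℝ, 0 < t → t ≤ -σ → ∀ y₀, gaussAngMom t y₀ (W σ) ≤ gaussAngMom 1 0 (W (-1))) ∧
      gaussInflow 1 0 (W (-1)) = -2 * gaussAngMom 1 0 (W (-1)) := by
  obtain ⟨hrate, hcont, hmild, hdiv⟩ := hv
  have hA : IsTypeIAncientMild C v := isTypeIAncientMild_of_class hrate hcont hmild hdiv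
  -- the full family of scale-invariant Gaussian angular momenta (all backward characteristics with apex `≤ 0`)
  set S : Set ℝ := {m | ∃ τ : ℝ, τ < 0 ∧ ∃ t : ℝ, 0 < t ∧ t ≤ -τ ∧ ∃ x₀ : EuclideanSpace ℝ (Fin 3),
    m = gaussAngMom t x₀ (v τ)} with hS
  have hSbdd : BddAbove S := by
    refine ⟨(4 * Real.pi) ^ ((3 : ℝ) / 2) * 2 * (2 * (2 : ℝ) ^ ((3 : ℝ) / 2)) * C, ?_⟩
    rintro m ⟨τ, hτ, t, ht, htτ, x₀, rfl⟩
    exact (le_abs_self _).trans (abs_gaussAngMom_le_of_le_neg hrate hτ ht htτ x₀)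
  obtain ⟨s₁, hs₁, y₁, hy₁⟩ := hpos
  have hmem₁ : gaussAngMom (-s₁) y₁ (v s₁) ∈ S := ⟨s₁, hs₁, -s₁, neg_pos.2 hs₁, le_rfl, y₁, rfl⟩
  have hSne : S.Nonempty := ⟨_, hmem₁⟩
  set Λ : ℝ := sSup S with hΛ
  have hpos₁ : 0 < gaussAngMom (-s₁) y₁ (v s₁) := by
    obtain ⟨hnn, hzero⟩ := gaussianCirculation_holds C v ⟨hrate, hcont, hmild, hdiv⟩ hsign y₁ (-s₁) s₁ (neg_pos.2 hs₁) hs₁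
    rcases hnn.lt_or_eq with h | h
    · exact h
    · exact absurd (hzero h.symm y₁) hy₁.ne'
  have hΛpos : 0 < Λ := lt_of_lt_of_le hpos₁ (le_csSup hSbdd hmem₁)
  have hleΛ : ∀ τ < 0, ∀ t : ℝ, 0 < t → t ≤ -τ → ∀ x₀, gaussAngMom t x₀ (v τ) ≤ Λ := fun τ hτ t ht htτ x₀ =>
    le_csSup hSbdd ⟨τ, hτ, t, ht, htτ, x₀, rfl⟩
  -- a maximising sequence `(τ_n, t_n, x_n)`
  obtain ⟨m, -, hmlim, hmS⟩ := exists_seq_tendsto_sSup hSne hSbdd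
  have hch : ∀ n, ∃ q : (ℝ × ℝ) × EuclideanSpace ℝ (Fin 3), q.1.1 < 0 ∧ 0 < q.1.2 ∧ q.1.2 ≤ -q.1.1 ∧
      m n = gaussAngMom q.1.2 q.2 (v q.1.1) := by
    intro n
    obtain ⟨τ, hτ, t, ht, htτ, x₀, h⟩ := hmS n
    exact ⟨((τ, t), x₀), hτ, ht, htτ, h⟩
  choose q hqτ hqt hqtτ hmq using hch
  set τn : ℕ → ℝ := fun n => (q n).1.1 with hτn
  set tn : ℕ → ℝ := fun n => (q n).1.2 with htn
  set xn : ℕ → EuclideanSpace ℝ (Fin 3) := fun n => (q n).2 with hxn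
  -- backward shifts `δ_n = -(τ_n + t_n) ≥ 0` and zooms `λ_n = √t_n`
  set δ : ℕ → ℝ := fun n => -(τn n + tn n) with hδ
  have hδ0 : ∀ n, 0 ≤ δ n := fun n => by simp only [hδ]; linarith [hqtτ n]
  set lam : ℕ → ℝ := fun n => Real.sqrt (tn n) with hlam
  have hlam0 : ∀ n, 0 < lam n := fun n => Real.sqrt_pos.2 (hqt n)
  have hlam2 : ∀ n, lam n ^ 2 = tn n := fun n => Real.sq_sqrt (hqt n).le
  set vs : ℕ → (ℝ → EuclideanSpace ℝ (Fin 3) → EuclideanSpace ℝ (Fin 3)) := fun n σ => v (σ - δ n) with hvs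
  have hvscl : ∀ n, IsTypeIAncientMild C (vs n) := fun n => hA.comp_sub_right (hδ0 n)
  have hPvs : ∀ n, P (vs n) := fun n => hshift v hA hPv (δ n) (hδ0 n)
  set w : ℕ → (ℝ → EuclideanSpace ℝ (Fin 3) → EuclideanSpace ℝ (Fin 3)) := fun n => lam n • stPull (lam n ^ 2) (lam n) 0 (xn n) (vs n) with hw
  have hwcl : ∀ n, IsTypeIAncientMild C (w n) := fun n => isTypeIAncientMild_zoom (hvscl n) (hlam0 n) (xn n)
  have hPw : ∀ n, P (w n) := fun n => hzoom (vs n) (hvscl n) (hPvs n) (lam n) (hlam0 n) (xn n)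
  have hw_fun : ∀ n σ, w n σ = fun z => lam n • v (lam n ^ 2 * σ - δ n) (xn n + lam n • z) := fun n σ =>
    funext fun z => zoom_apply (lam n) (xn n) (vs n) σ z
  -- zoom invariance on the characteristic family
  have hwG : ∀ n, ∀ σ < 0, ∀ t : ℝ, 0 < t → ∀ y₀, gaussAngMom t y₀ (w n σ) =
      gaussAngMom (lam n ^ 2 * t) (xn n + lam n • y₀) (v (lam n ^ 2 * σ - δ n)) := by
    intro n σ hσ t ht y₀
    rw [hw_fun, gaussAngMom_zoom (hlam0 n) ht (xn n) y₀ (v (lam n ^ 2 * σ - δ n))]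
  have hwGle : ∀ n, ∀ σ < 0, ∀ t : ℝ, 0 < t → t ≤ -σ → ∀ y₀, gaussAngMom t y₀ (w n σ) ≤ Λ := by
    intro n σ hσ t ht htσ y₀
    rw [hwG n σ hσ t ht y₀]
    have hl2 : 0 < lam n ^ 2 := pow_pos (hlam0 n) 2
    refine hleΛ _ ?_ _ (mul_pos hl2 ht) ?_ _
    · have := mul_neg_of_pos_of_neg hl2 hσ; linarith [hδ0 n]
    · have h1 : lam n ^ 2 * t ≤ lam n ^ 2 * (-σ) := mul_le_mul_of_nonneg_left htσ hl2.le
      linarith [hδ0 n]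
  have hwG1 : ∀ n, gaussAngMom 1 0 (w n (-1)) = m n := by
    intro n
    have e2 : lam n ^ 2 * (-1) - δ n = τn n := by simp only [hδ]; rw [hlam2]; ring
    rw [hwG n (-1) (by norm_num) 1 one_pos 0, hmq n, smul_zero, add_zero, mul_one, e2, hlam2]
  -- compactness
  obtain ⟨φ, hφ, W, hW, hpt, hptG, hlu, hluG⟩ := exists_tendsto_of_isTypeIAncientMild_seq C hwcl
  have hWdoor : InDoorClass C W := inDoorClass_of_isTypeIAncientMild hW
  -- `P` passes to the limit
  have hPW : P W := hlim (fun j => w (φ j)) W (fun j => hwcl (φ j)) (fun j => hPw (φ j)) hW hpt hptG hlu hluG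
  have hGlim : ∀ σ < 0, ∀ t : ℝ, 0 < t → ∀ y₀,
      Tendsto (fun j => gaussAngMom t y₀ (w (φ j) σ)) atTop (𝓝 (gaussAngMom t y₀ (W σ))) := by
    intro σ hσ t ht y₀
    exact tendsto_gaussAngMom (B := C / Real.sqrt (-σ)) ht (fun j => (hwcl (φ j)).continuous_slice hσ)
      (fun j x => (hwcl (φ j)).norm_le hσ x) (fun x => hpt σ hσ x) y₀
  have hG1 : gaussAngMom 1 0 (W (-1)) = Λ := by
    have h1 := hGlim (-1) (by norm_num) 1 one_pos 0
    have h2 : Tendsto (fun j => gaussAngMom 1 0 (w (φ j) (-1))) atTop (𝓝 Λ) := by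
      refine (hmlim.comp hφ.tendsto_atTop).congr fun j => ?_
      simp only [Function.comp_apply, hwG1]
    exact tendsto_nhds_unique h1 h2
  have hGle : ∀ σ < 0, ∀ t : ℝ, 0 < t → t ≤ -σ → ∀ y₀, gaussAngMom t y₀ (W σ) ≤ Λ := fun σ hσ t ht htσ y₀ =>
    le_of_tendsto' (hGlim σ hσ t ht y₀) fun j => hwGle (φ j) σ hσ t ht htσ y₀
  -- the sign passes to the limit
  have hWsign : SignE3 W := by
    intro σ hσ y
    have hc : Tendsto (fun j => ⟪curl (w (φ j) σ) y, e3⟫) atTop (𝓝 ⟪curl (W σ) y, e3⟫) :=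
      (tendsto_curl_of_tendsto_fderiv (hptG σ hσ y)).inner tendsto_const_nhds
    refine ge_of_tendsto' hc fun j => ?_
    have hcurl : curl (w (φ j) σ) y =
        (lam (φ j) * lam (φ j)) • curl (vs (φ j) (0 + lam (φ j) ^ 2 * σ)) (xn (φ j) + lam (φ j) • y) :=
      curl_smul_stPull (lam (φ j)) (lam (φ j) ^ 2) (lam (φ j)) 0 (xn (φ j)) (vs (φ j)) σ y
    rw [hcurl, real_inner_smul_left]
    refine mul_nonneg (mul_self_nonneg _) (hsign _ ?_ _)
    have := mul_neg_of_pos_of_neg (pow_pos (hlam0 (φ j)) 2) hσ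
    linarith [hδ0 (φ j)]
  -- Fermat on the characteristic through the apex
  have hmax : IsLocalMax (fun σ : ℝ => gaussAngMom (-σ) 0 (W σ)) (-1) := by
    filter_upwards [Iio_mem_nhds (show (-1 : ℝ) < 0 by norm_num)] with σ hσ
    rw [neg_neg, hG1]
    exact hGle σ hσ (-σ) (neg_pos.2 hσ) le_rfl 0
  have hI := gaussInflow_eq_of_isLocalMax hWdoor hmax
  refine ⟨W, hWdoor, hWsign, hPW, ?_, ?_, hI⟩
  · rw [hG1]; exact hΛpos
  · intro σ hσ t ht htσ y₀
    rw [hG1]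
    exact hGle σ hσ t ht htσ y₀

/-- **CENSUS TOOL (first form): a stratum {closed hemisphere} ∩ {P} of W6 is DEAD once no single closed-hemisphere door-class `W ∈ P`
is Gaussian-extremal** (maximal `Λ = 𝒢(1;0)[W(−1)] > 0` over the whole characteristic family, maximal inflow `ℐ(1;0)[W(−1)] = −2Λ`), for
`P` invariant under backward shifts and zooms and closed under the F3 convergence: then every closed-hemisphere door-class profile in `P`
is poloidal (`⟪curl v, e₃⟫ ≡ 0`). -/
theorem inner_curl_e3_eq_zero_of_invariant (P : (ℝ → EuclideanSpace ℝ (Fin 3) → EuclideanSpace ℝ (Fin 3)) → Prop)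
    (hshift : ∀ u : (ℝ → EuclideanSpace ℝ (Fin 3) → EuclideanSpace ℝ (Fin 3)), IsTypeIAncientMild C u → P u → ∀ δ : ℝ, 0 ≤ δ → P (fun σ => u (σ - δ)))
    (hzoom : ∀ u : (ℝ → EuclideanSpace ℝ (Fin 3) → EuclideanSpace ℝ (Fin 3)), IsTypeIAncientMild C u → P u → ∀ c : ℝ, 0 < c → ∀ x₀ : EuclideanSpace ℝ (Fin 3),
      P (c • stPull (c ^ 2) c 0 x₀ u))
    (hlim : ∀ (w : ℕ → (ℝ → EuclideanSpace ℝ (Fin 3) → EuclideanSpace ℝ (Fin 3))) (W : (ℝ → EuclideanSpace ℝ (Fin 3) → EuclideanSpace ℝ (Fin 3))), (∀ j, IsTypeIAncientMild C (w j)) → (∀ j, P (w j)) → IsTypeIAncientMild C W →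
      (∀ t < 0, ∀ x, Tendsto (fun j => w j t x) atTop (𝓝 (W t x))) →
      (∀ t < 0, ∀ x, Tendsto (fun j => fderiv ℝ (w j t) x) atTop (𝓝 (fderiv ℝ (W t) x))) →
      (∀ t < 0, TendstoLocallyUniformly (fun j => w j t) (W t) atTop) →
      (∀ t < 0, TendstoLocallyUniformly (fun j => fderiv ℝ (w j t)) (fderiv ℝ (W t)) atTop) → P W)
    (hkill : ∀ W : (ℝ → EuclideanSpace ℝ (Fin 3) → EuclideanSpace ℝ (Fin 3)), InDoorClass C W → SignE3 W → P W →
      0 < gaussAngMom 1 0 (W (-1)) →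
      (∀ σ < 0, ∀ t : ℝ, 0 < t → t ≤ -σ → ∀ y₀, gaussAngMom t y₀ (W σ) ≤ gaussAngMom 1 0 (W (-1))) →
      gaussInflow 1 0 (W (-1)) = -2 * gaussAngMom 1 0 (W (-1)) → False)
    {v : (ℝ → EuclideanSpace ℝ (Fin 3) → EuclideanSpace ℝ (Fin 3))} (hv : InDoorClass C v) (hPv : P v) (hsign : SignE3 v) :
    ∀ s < 0, ∀ y, ⟪curl (v s) y, e3⟫ = 0 := by
  intro s hs y
  by_contra hne
  have hpos : 0 < ⟪curl (v s) y, e3⟫ := lt_of_le_of_ne (hsign s hs y) (Ne.symm hne)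
  obtain ⟨W, hW, hWs, hPW, hΛ, hmax, hI⟩ :=
    exists_gaussExtremal_of_invariant P hshift hzoom hlim hv hPv hsign ⟨s, hs, y, hpos⟩
  exact hkill W hW hWs hPW hΛ hmax hI

/-- **CENSUS TOOL (joint form): the stratum {closed hemisphere} ∩ {P} is DEAD once no single closed-hemisphere door-class `W ∈ P` carries
the JOINT EXTREMAL SYSTEM** of `…GaussExtremalJoint` — the first-order system (E0)–(E3) (`firstOrder_of_extremal`), the moment / Hessian /
centering package (`moments_of_extremal`), the tilting / stretching package (`tilting_of_extremal`), the classical Navier–Stokes form of `∂ₜW`,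
and the second-order condition `0 ≤ dℐ(−σ;0)[W(σ)]/dσ|_{σ=−1}` of `…GaussExtremalSecondOrder` — for `P` invariant under backward shifts and zooms
and closed under the F3 convergence. -/
theorem inner_curl_e3_eq_zero_of_invariant_joint (P : (ℝ → EuclideanSpace ℝ (Fin 3) → EuclideanSpace ℝ (Fin 3)) → Prop)
    (hshift : ∀ u : (ℝ → EuclideanSpace ℝ (Fin 3) → EuclideanSpace ℝ (Fin 3)), IsTypeIAncientMild C u → P u → ∀ δ : ℝ, 0 ≤ δ → P (fun σ => u (σ - δ)))
    (hzoom : ∀ u : (ℝ → EuclideanSpace ℝ (Fin 3) → EuclideanSpace ℝ (Fin 3)), IsTypeIAncientMild C u → P u → ∀ c : ℝ, 0 < c → ∀ x₀ : EuclideanSpace ℝ (Fin 3),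
      P (c • stPull (c ^ 2) c 0 x₀ u))
    (hlim : ∀ (w : ℕ → (ℝ → EuclideanSpace ℝ (Fin 3) → EuclideanSpace ℝ (Fin 3))) (W : (ℝ → EuclideanSpace ℝ (Fin 3) → EuclideanSpace ℝ (Fin 3))), (∀ j, IsTypeIAncientMild C (w j)) → (∀ j, P (w j)) → IsTypeIAncientMild C W →
      (∀ t < 0, ∀ x, Tendsto (fun j => w j t x) atTop (𝓝 (W t x))) →
      (∀ t < 0, ∀ x, Tendsto (fun j => fderiv ℝ (w j t) x) atTop (𝓝 (fderiv ℝ (W t) x))) →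
      (∀ t < 0, TendstoLocallyUniformly (fun j => w j t) (W t) atTop) →
      (∀ t < 0, TendstoLocallyUniformly (fun j => fderiv ℝ (w j t)) (fderiv ℝ (W t)) atTop) → P W)
    (hkill : ∀ W : (ℝ → EuclideanSpace ℝ (Fin 3) → EuclideanSpace ℝ (Fin 3)), InDoorClass C W → SignE3 W → P W →
      (0 < heatExtension (fun x => ⟪curl (W (-1)) x, e3⟫) 1 0 ∧
        (∀ y, heatExtension (fun x => ⟪curl (W (-1)) x, e3⟫) 1 y ≤ heatExtension (fun x => ⟪curl (W (-1)) x, e3⟫) 1 0) ∧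
        (∀ t : ℝ, 0 < t → t ≤ 1 →
          t * heatExtension (fun x => ⟪curl (W (-1)) x, e3⟫) t 0 ≤ heatExtension (fun x => ⟪curl (W (-1)) x, e3⟫) 1 0) ∧
        (Δ (heatExtension (fun x => ⟪curl (W (-1)) x, e3⟫) 1)) 0 ≤ 0 ∧
        0 ≤ heatExtension (fun x => ⟪curl (W (-1)) x, e3⟫) 1 0 + (Δ (heatExtension (fun x => ⟪curl (W (-1)) x, e3⟫) 1)) 0 ∧
        gaussInflow 1 0 (W (-1)) = -2 * ((4 * Real.pi) ^ ((3 : ℝ) / 2) * 2 * heatExtension (fun x => ⟪curl (W (-1)) x, e3⟫) 1 0)) →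
      (0 < ∫ y, heatKernel 1 y * curl (W (-1)) y 2 ∧
        (∀ e : EuclideanSpace ℝ (Fin 3),
          ∫ y, ⟪y, e⟫ ^ 2 * heatKernel 1 y * curl (W (-1)) y 2 ≤ 2 * ‖e‖ ^ 2 * ∫ y, heatKernel 1 y * curl (W (-1)) y 2) ∧
        (∀ i : Fin 3, ∫ y, (y i) ^ 2 * heatKernel 1 y * curl (W (-1)) y 2 ≤ 2 * ∫ y, heatKernel 1 y * curl (W (-1)) y 2) ∧
        ∫ y, ((y 0) ^ 2 + (y 1) ^ 2) * heatKernel 1 y * curl (W (-1)) y 2 ≤ 4 * ∫ y, heatKernel 1 y * curl (W (-1)) y 2 ∧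
        2 * ∫ y, heatKernel 1 y * curl (W (-1)) y 2 ≤ ∫ y, ‖y‖ ^ 2 * heatKernel 1 y * curl (W (-1)) y 2 ∧
        ∫ y, ‖y‖ ^ 2 * heatKernel 1 y * curl (W (-1)) y 2 ≤ 6 * ∫ y, heatKernel 1 y * curl (W (-1)) y 2 ∧
        (∀ u : EuclideanSpace ℝ (Fin 3), ∫ y, heatKernel 1 y * ⟪y, u⟫ * curl (W (-1)) y 2 = 0) ∧
        gaussInflow 1 0 (W (-1)) = -2 * ((4 * Real.pi) ^ ((3 : ℝ) / 2) * 2 * ∫ y, heatKernel 1 y * curl (W (-1)) y 2)) →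
      ((∫ y, heatKernel 1 y * ((y 0 * W (-1) y 0 + y 1 * W (-1) y 1) * curl (W (-1)) y 2)) -
            (∫ y, heatKernel 1 y * ((y 0 * curl (W (-1)) y 0 + y 1 * curl (W (-1)) y 1) * W (-1) y 2)) =
          -2 * ∫ y, heatKernel 1 y * curl (W (-1)) y 2 ∧
        |∫ y, heatKernel 1 y * ((y 0 * W (-1) y 0 + y 1 * W (-1) y 1) * curl (W (-1)) y 2)| ≤
          2 * C * ∫ y, heatKernel 1 y * curl (W (-1)) y 2 ∧
        (2 - 2 * C) * ∫ y, heatKernel 1 y * curl (W (-1)) y 2 ≤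
          ∫ y, heatKernel 1 y * ((y 0 * curl (W (-1)) y 0 + y 1 * curl (W (-1)) y 1) * W (-1) y 2) ∧
        ∫ y, heatKernel 1 y * ((y 0 * curl (W (-1)) y 0 + y 1 * curl (W (-1)) y 1) * W (-1) y 2) ≤
          (2 + 2 * C) * ∫ y, heatKernel 1 y * curl (W (-1)) y 2 ∧
        ∫ y, heatKernel 1 y * angMom 0 (W (-1)) y = 2 * ∫ y, heatKernel 1 y * curl (W (-1)) y 2 ∧
        ∫ y, heatKernel 1 y * ((y 0 * curl (W (-1)) y 0 + y 1 * curl (W (-1)) y 1) * W (-1) y 2) =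
          (∫ y, heatKernel 1 y * (angMom 0 (W (-1)) y * fderiv ℝ (W (-1)) y (EuclideanSpace.single 2 1) 2)) -
            1 / 2 * ∫ y, heatKernel 1 y * (y 2 * W (-1) y 2 * angMom 0 (W (-1)) y)) →
      (∃ p : ℝ → EuclideanSpace ℝ (Fin 3) → ℝ, IsClassicalNSSolutionOn (Iio (0 : ℝ)) 1 0 W p ∧
        ∀ s < (0 : ℝ), ∀ x, deriv (fun τ => W τ x) s = (Δ (W s)) x - convect (W s) (W s) x - gradient (p s) x) →
      0 ≤ (4 * Real.pi) ^ ((3 : ℝ) / 2) *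
          ∫ x, (-((‖x - 0‖ ^ 2 / (4 * (0 - (-1 : ℝ)) ^ 2) - (3 : ℝ) / (2 * (0 - (-1 : ℝ)))) * heatKernel (0 - (-1 : ℝ)) (x - 0)) *
              (⟪x - 0, W (-1) x⟫ * angMom 0 (W (-1)) x) +
            heatKernel (0 - (-1 : ℝ)) (x - 0) *
              (⟪x - 0, deriv (fun τ => W τ x) (-1)⟫ * angMom 0 (W (-1)) x +
                ⟪x - 0, W (-1) x⟫ * ((x - 0) 0 * deriv (fun τ => W τ x) (-1) 1 - (x - 0) 1 * deriv (fun τ => W τ x) (-1) 0))) →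
      False)
    {v : (ℝ → EuclideanSpace ℝ (Fin 3) → EuclideanSpace ℝ (Fin 3))} (hv : InDoorClass C v) (hPv : P v) (hsign : SignE3 v) :
    ∀ s < 0, ∀ y, ⟪curl (v s) y, e3⟫ = 0 := by
  refine inner_curl_e3_eq_zero_of_invariant P hshift hzoom hlim (fun W hW hWs hPW hΛ hmax hI => ?_) hv hPv hsign
  have hm1 : (-1 : ℝ) < 0 := by norm_num
  -- the second-order condition along the apex-0 characteristic (as in `…SecondOrder.gaussExtremal_secondOrder`)
  have hJ := hasDerivAt_gaussInflow_of_class hW 0 hm1 hm1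
  set f : ℝ → ℝ := fun σ => gaussAngMom (0 - σ) 0 (W σ) with hf
  set J : ℝ → ℝ := fun σ => gaussInflow (0 - σ) 0 (W σ) with hJdef
  have hswirl : ∀ σ < 0, HasDerivAt f (-(f σ + J σ / 2) / (-σ)) σ := by
    intro σ hσ
    have h := gaussianSwirlLaw_holds C W hW 0 0 σ hσ hσ
    simp only [hf, hJdef]
    refine h.congr_deriv ?_
    have hσ0 : σ ≠ 0 := hσ.ne
    have hσ0' : -σ ≠ 0 := neg_ne_zero.2 hσ0
    rw [zero_sub]
    field_simp
    ring
  have hfmax : ∀ σ < 0, f σ ≤ f (-1) := by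
    intro σ hσ
    have h := hmax σ hσ (-σ) (neg_pos.2 hσ) le_rfl 0
    simp only [hf]
    rw [zero_sub, zero_sub, neg_neg]
    exact h
  have h0 : f (-1) + J (-1) / 2 = 0 := by
    simp only [hf, hJdef]
    rw [zero_sub, neg_neg, hI]
    ring
  have h2 := deriv_nonneg_of_max_of_swirl hfmax hswirl h0 hJ
  exact hkill W hW hWs hPW (firstOrder_of_extremal hW hΛ hmax hI) (moments_of_extremal hW hΛ hmax hI)
    (tilting_of_extremal hW hWs hΛ hmax hI) (exists_pressure_deriv_eq_of_class hW) h2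

end Summit.NavierStokesRegularity.NavierStokesRegularity.Theorems.HalfSpaceWindowDoorCirculationCarryingRigidityGaussExtremalInvariant

end
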